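import Summits.QuantumFields.QCD.Theses.PauliWegnerSea
import Summits.QuantumFields.QCD.Theses.WilsonMobilityGap
import Literature.MathematicalPhysics.QuantumFieldTheory.QCDPhaseQuenchedMomentUpgrade
import Literature.Barriers.QuantumFields.WilsonDeterminantSign
import HarnessLib.Audit

/-!
# Line `sea-repulsion-exponent` for crux `PauliWegnerSea.PhaseQuenchedFlavourDecay`
# (stmt-QuantumFields-9151; rank 6 of route-QuantumFields-PauliWegnerSea, rank 3 of
# route-QuantumFields-WilsonMobilityGap — one shared decl)

Skeleton (crux-plan, round 1, planner-cruxplan-stmt-QuantumFields-9151-sea-repulsion-expone-0,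
2026-08-16) of the crux idea `Ideas/sea-repulsion-exponent.md` ("the sea pays every pole once",
ideator 1; triage r1-1/2/3: pass ×3 with sharpenings (Q) quantifier order, (M) multi-flavour minors,
§B UPPER-guard, multi-scale r-level form, first lemma already in tree).

The crux, verbatim (route file rev 4, l.493): `∀ N_f reg m > 0, UPPER(reg,m) → CONC(reg,m)` with
UPPER = clause (ii) of `MobilityGap` (phase-quenched `s<1` fractional-moment decay of the colour–spin
block of `G_f = D⁻¹`, rate `δ a_k`, volume-uniform) and CONC = `∃ δ' > 0 ∀ R R' A B, Charged_{f₀,q≠0} A →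
∃ C' ∀ᶠ k ∀ S ≥ L_k ∀ n ≤ S, ‖⟨ ⟨A(0)B(n e₀)⟩_F ⟩₊‖ ≤ C' e^{-δ' a_k n}`.  `Upper`, `Conc` below are
byte-identical re-packagings (`crux_iff` is `Iff.rfl`, as the disprover's `phaseQuenchedFlavourDecay_iff`).

## The line in one paragraph

Write `H = Γ₅ D` for the Hermitian `N_f`-flavour Wilson–Dirac matrix (`hermitianDiracMatrix`,
flavour-block-diagonal with blocks `γ₅ D_W(m_f(k))` = tree `hermitianWilsonDirac`).  Every Wick term of
every pair of quark boxes is a QuarkVar-indexed minor `det D⁻¹[I,J]` (product over flavours of minors of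
the `G_f`), and by COMPOUND-MATRIX Cauchy–Schwarz + Jensen (the card's "local singular values, each pole
paid once", made canonical):

  `|det D⁻¹[I,J]|^p ≤ ½ (det (|H|^{-p})[I,I] + det (|H|^{-p})[J,J])`,
  `det(|H|^{-p})[I,I] = Σ_{|S|=r} |det Φ_S(I)|² · Π_{α∈S} |λ_α|^{-p}`   (`Σ_S |det Φ_S(I)|² = 1`):

`r` DISTINCT modes of `H`, each raised to the power `-p` — the multi-scale `r`-level Minami quantity of
TRIAGE r1-2 (b) / r1-3 §A in integrated, basis-free form (`cfc (|·|^{-p}) H`, `seaKernel`).  So the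
crux's `s<1 → 1` gap is EXACTLY a volume- and `k`-uniform bound on phase-quenched expectations of
principal minors of negative powers of `|Γ₅ D|` with ONE exponent `p > 1` for all minor sizes `r`
(`SeaRepulsion`, `stub_seaRepulsion`: the physics, HARDEST, guarded by UPPER per §B); the rest is
provable now: `stub_minorDomination` (the inequality above + Markov ⇒ the disprover's volume-uniform
LOCAL TAIL `P₊(|minor| > t) ≤ B t^{-p}` for all minors, `MinorTail`), `stub_crossingSplit` (card
`crossing-split-integrability`'s `SplitBound` + Laplace-by-crossing-matchings + UPPER/Markov + torus
translation: charged minors decay at an `r`-FREE rate, `ChargedMinorDecay` — this replaces the idea card's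
Hölder-over-`r` transfer, which violates (Q)), `stub_wickReduction` (Berezin/Wick in determinant form +
the charge selection rule on monomials + `QCDLatticeObservable.bounded`: `ChargedMinorDecay → Conc`).
`PhaseQuenchedFlavourDecay_of` composes the four BY NAME (kernel-checked, no `sorry`).

## Disproof.lean / negatives honoured

`Disproof.lean` (cdisprove v1–v5, payload `disproof_path`) is not mounted in this jail (`run/gate` absent;
`ledger crux cat … Disproof.lean`: no workfile) — used through its evidence notes, as the three triagers did:
* `PhaseQuenchedFlavourDecay_false_without_charge`, `phaseQuenchedFlavourDecay_false_without_qNeZero`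
  (Charged / `q ≠ 0` load-bearing) — HONOURED: the line uses the charge at `stub_wickReduction` (selection
  rule: every monomial of `A.F U` has `f₀`-imbalance `q ≠ 0`) and `q ≠ 0` is exactly the `≠` of
  `ChargedMinorDecay` consumed by `stub_crossingSplit` (≥ 1 crossing entry per permutation term);
* `_false_without_upper` (sorried near-miss) — the line uses UPPER at `stub_seaRepulsion` (guard, §B) and
  at `stub_crossingSplit` (the crossing event is rare ONLY by UPPER + Markov);
* `phaseQuenchedFlavourDecay_iff_bare` (mass positivity is decoration) — respected: no stub uses `0 < m_f`
  except to pass it on; `upper_of_heavy` / `crux_hypotheses_inhabited` (anti-vacuity) — the heavy regime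
  is where every stub is easy (Neumann series), a sanity check for provers;
* §4/(f) `crux ⟸ Upper ∧ LocalTail(p>1) ∧ Wick layer cake`, `firstMomentDecay_of_upper_of_localTailEntry`,
  landed `FractionalMomentTail` / `QCDPhaseQuenchedMomentUpgrade` — ADOPTED: `MinorTail` IS LocalTail for
  minors (same `Measure.real {t < ·} ≤ B t^{-p}` shape, same measure `qcdLatticeMeasure`), so the landed
  layer-cake lemmas are the tools of `stub_crossingSplit`; the card's `ChebyshevInterpolation` is NOT a
  stub (triage: already a theorem).
No `Theorems/PhaseQuenchedFlavourDecay/Negative/` lemma has landed (2026-08-16), so no stub can be an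
instance of one.  `ledger negatives --problem QuantumFields` (9665 diagonal-mirror RP, 9603/9599
MultibosonBridge, 9494 adaptive coarse system): untouched — no reflection positivity, no root ladders, no
block-spin system anywhere in this line.
-/

open scoped BigOperators ENNReal
open MeasureTheory Filter
open Literature.MathematicalPhysics.QuantumFieldTheory Literature.MathematicalPhysics.QuantumLattice
  Literature.Probability.LatticeModels
open Literature.Barriers.QuantumFields.WilsonDeterminant

noncomputable section

namespace Summit.QuantumFields.QCD.Cruxes.PhaseQuenchedFlavourDecay.SeaRepulsionExponent

open Classical

/-! ### §0a Vocabulary -/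

/-- `SU(3)` lattice gauge fields on the four-torus of side `N`. -/
abbrev Cfg (N : ℕ) : Type := GaugeConfig 4 N SU3

section Vocabulary

variable {Nf N : ℕ} [NeZero N]

/-- **The Hermitian `N_f`-flavour Wilson–Dirac matrix** `H(U) = Γ₅ D(U) = ⊕_f γ₅ D_W(U, m_f, 1)`,
flavour-block-diagonal exactly like the tree's `diracMatrix` (same `quarkEquiv` reindexing), with blocks
the tree's `hermitianWilsonDirac` (`= spinorLift gammaFive * wilsonDirac`).  `Γ₅` is a diagonal `±1`
matrix (`spinorLift_gammaFive_eq_diagonal`), so `D⁻¹ = H⁻¹ Γ₅` and every minor of `D⁻¹` has the modulus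
of the same minor of `H⁻¹`. -/
def hermitianDiracMatrix (U : Cfg N) (mq : Fin Nf → ℝ) : Matrix (FermiIdx Nf N) (FermiIdx Nf N) ℂ :=
  Matrix.reindex quarkEquiv quarkEquiv <| Matrix.of fun v w : QuarkVar Nf N =>
    if v.1 = w.1 then hermitianWilsonDirac (fundamentalRep (Fin 3)) U (mq v.1) 1 v.2 w.2 else 0

/-- `H(U)` is Hermitian (block-diagonal of Hermitian blocks; tree `isHermitian_hermitianWilsonDirac`).
Proved here so that `seaKernel` below is visibly NOT the `cfc` junk value. -/
theorem isHermitian_hermitianDiracMatrix (U : Cfg N) (mq : Fin Nf → ℝ) :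
    (hermitianDiracMatrix U mq).IsHermitian := by
  have hb : ∀ m₀ : ℝ, (hermitianWilsonDirac (fundamentalRep (Fin 3)) U m₀ 1).IsHermitian :=
    fun m₀ => isHermitian_hermitianWilsonDirac _ fundamentalRep_mem_unitaryGroup U m₀ 1
  have hM : (Matrix.of fun v w : QuarkVar Nf N =>
      if v.1 = w.1 then hermitianWilsonDirac (fundamentalRep (Fin 3)) U (mq v.1) 1 v.2 w.2
        else 0).IsHermitian := by
    rw [Matrix.IsHermitian]
    ext v w
    simp only [Matrix.conjTranspose_apply, Matrix.of_apply]
    by_cases h : v.1 = w.1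
    · rw [if_pos h, if_pos h.symm, h]
      exact (hb (mq w.1)).apply v.2 w.2
    · rw [if_neg h, if_neg (Ne.symm h), star_zero]
  simpa only [hermitianDiracMatrix, Matrix.reindex_apply] using hM.submatrix _

/-- `Γ₅ = 1 ⊗ 1 ⊗ γ₅` on one flavour (tree `spinorLift gammaFive`), as a constant family over flavours. -/
def gammaFamily (Nf N : ℕ) [NeZero N] : Fin Nf → Matrix (Idx N 3) (Idx N 3) ℂ :=
  fun _ => spinorLift gammaFive

/-- **`Γ` = the flavour-block-diagonal `Γ₅` on all quark variables** (same reindexing as `diracMatrix`). -/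
def gammaBig (Nf N : ℕ) [NeZero N] : Matrix (FermiIdx Nf N) (FermiIdx Nf N) ℂ :=
  Matrix.reindex quarkEquiv quarkEquiv <| Matrix.of fun v w : QuarkVar Nf N =>
    if v.1 = w.1 then gammaFamily Nf N v.1 v.2 w.2 else 0

omit [NeZero N] in
/-- Flavour-first block-diagonal matrices are Mathlib's `blockDiagonal` with the two factors swapped. -/
theorem of_block_eq (A : Fin Nf → Matrix (Idx N 3) (Idx N 3) ℂ) :
    (Matrix.of fun v w : QuarkVar Nf N => if v.1 = w.1 then A v.1 v.2 w.2 else 0) =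
      (Matrix.blockDiagonal A).submatrix (Equiv.prodComm (Fin Nf) (Idx N 3))
        (Equiv.prodComm (Fin Nf) (Idx N 3)) := by
  ext v w
  simp only [Matrix.of_apply, Matrix.submatrix_apply, Equiv.prodComm_apply, Prod.swap,
    Matrix.blockDiagonal_apply]

/-- Block-diagonal matrices multiply blockwise. -/
theorem blockMul (A B : Fin Nf → Matrix (Idx N 3) (Idx N 3) ℂ) :
    ((Matrix.of fun v w : QuarkVar Nf N => if v.1 = w.1 then A v.1 v.2 w.2 else 0) *
      (Matrix.of fun v w : QuarkVar Nf N => if v.1 = w.1 then B v.1 v.2 w.2 else 0)) =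
      Matrix.of fun v w : QuarkVar Nf N => if v.1 = w.1 then (A v.1 * B v.1) v.2 w.2 else 0 := by
  rw [of_block_eq, of_block_eq, of_block_eq (fun f => A f * B f), Matrix.submatrix_mul_equiv,
    Matrix.blockDiagonal_mul]

/-- **`H = Γ D`**: the Hermitian matrix of this line is `Γ` times the tree's `diracMatrix` (sorry-free; the
starting point of `stub_minorDomination`: with `Γ² = 1` below, `D⁻¹ = H⁻¹ Γ`). -/
theorem hermitianDiracMatrix_eq_mul (U : Cfg N) (mq : Fin Nf → ℝ) :
    hermitianDiracMatrix U mq = gammaBig Nf N * diracMatrix U mq := by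
  unfold hermitianDiracMatrix gammaBig diracMatrix
  rw [Matrix.reindex_apply, Matrix.reindex_apply, Matrix.reindex_apply,
    Matrix.submatrix_mul_equiv,
    blockMul (A := gammaFamily Nf N) (B := fun f => wilsonDirac (fundamentalRep (Fin 3)) U (mq f) 1)]
  rfl

/-- **`Γ² = 1`** (sorry-free; `spinorLift_gammaFive_mul_self` blockwise). -/
theorem gammaBig_mul_self : gammaBig Nf N * gammaBig Nf N = 1 := by
  unfold gammaBig
  rw [Matrix.reindex_apply, Matrix.submatrix_mul_equiv, blockMul]
  have h1 : ∀ f : Fin Nf, gammaFamily Nf N f * gammaFamily Nf N f = 1 :=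
    fun f => spinorLift_gammaFive_mul_self
  simp only [h1]
  ext i j
  simp only [Matrix.submatrix_apply, Matrix.of_apply, Matrix.one_apply]
  by_cases hij : i = j
  · subst hij; simp
  · have hne : quarkEquiv.symm i ≠ quarkEquiv.symm j := fun h => hij (quarkEquiv.symm.injective h)
    rw [if_neg hij]
    rw [Ne, Prod.ext_iff, not_and_or] at hne
    rcases hne with h | h
    · simp [h]
    · by_cases h1 : (quarkEquiv.symm i).1 = (quarkEquiv.symm j).1 <;> simp [h1, h]

/-- **The sea kernel `|H(U)|^{-p}`** (continuous functional calculus of the Hermitian matrix `H(U)`;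
`= U diag(|λ_α|^{-p}) U⋆` in any eigenbasis, `Matrix.IsHermitian.cfc_eq`; junk `|0|^{-p} = 0` on the
divisor `{det D = 0}`, which is `|det D| dμ_W`-null).  Its principal `r × r` minor at quark indices `I` is
`det(|H|^{-p})[I,I] = Σ_{|S| = r} |det Φ_S(I)|² Π_{α ∈ S} |λ_α|^{-p}` (Cauchy–Binet): `r` DISTINCT modes,
each to the power `-p` — "the sea must pay every pole once". -/
def seaKernel (U : Cfg N) (mq : Fin Nf → ℝ) (p : ℝ) : Matrix (FermiIdx Nf N) (FermiIdx Nf N) ℂ :=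
  cfc (fun x : ℝ => |x| ^ (-p)) (hermitianDiracMatrix U mq)

/-- The QuarkVar-indexed `r × r` Wick minor `|det D(U)⁻¹[I, J]|` of the inverse `N_f`-flavour Wilson–Dirac
matrix (rows `I` = the `ψ` indices, columns `J` = the `ψ̄` indices of a Wick monomial; Mathlib `Matrix.inv`,
junk `0` on `{det D = 0}`; a product over flavours of minors of the `G_f`, zero unless flavour counts
match). -/
def wickMinor {r : ℕ} (U : Cfg N) (mq : Fin Nf → ℝ) (I J : Fin r → QuarkVar Nf N) : ℝ :=
  ‖((diracMatrix U mq)⁻¹.submatrix (fun t => quarkEquiv (I t)) (fun t => quarkEquiv (J t))).det‖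

/-- Torus site of a quark variable. -/
abbrev siteOf (w : QuarkVar Nf N) : TorusSite 4 N := w.2.1

end Vocabulary

/-- The crux's bare-mass trajectory `m_f(k) = m_crit(k) + a_k m_f / Z_m(k)`. -/
abbrev bare {Nf : ℕ} (reg : QCDRegularisation Nf) (m : Fin Nf → ℝ) (k : ℕ) : Fin Nf → ℝ :=
  fun fl => reg.mcrit k + reg.a k * m fl / reg.Zm k

/-- `x` lies in the sup-norm ball of radius `R` about (the projection of) `c ∈ ℤ⁴` on the torus of side
`2S+1` — the footprint of a quark box `QCDLatticeObservable Nf R` placed at `c` by `onTorus`. -/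
def InBall (S : ℕ) (c : Literature.Probability.LatticeModels.Site 4) (R : ℕ) (x : TorusSite 4 (2 * S + 1)) :
    Prop :=
  ∃ u ∈ box 4 R, x = Torus.proj (2 * S + 1) (c + u)

/-! ### §0b Packaging of the crux (verbatim clause texts) -/

section Packaging

variable {Nf : ℕ}

/-- UPPER = clause (ii) of `MobilityGap` for `(reg, m)` — the crux's hypothesis, verbatim. -/
def Upper (reg : QCDRegularisation Nf) (m : Fin Nf → ℝ) : Prop :=
  ∃ s δ C : ℝ, 0 < s ∧ s < 1 ∧ 0 < δ ∧ ∀ᶠ k in atTop, ∀ S : ℕ, reg.L k ≤ S → ∀ (f : Fin Nf) (v : Literature.Probability.LatticeModels.Site 4), v ∈ box 4 S → (∫ U : GaugeConfig 4 (2 * S + 1) (Matrix.specialUnitaryGroup (Fin 3) ℂ), ‖(diracMatrix U fun fl => reg.mcrit k + reg.a k * m fl / reg.Zm k).det‖ * (∑ a : Fin 3, ∑ i : Fin 4, ∑ b : Fin 3, ∑ j : Fin 4, ‖(diracMatrix U fun fl => reg.mcrit k + reg.a k * m fl / reg.Zm k)⁻¹ (quarkEquiv (f, (Torus.proj (2 *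 S + 1) 0, a, i))) (quarkEquiv (f, (Torus.proj (2 * S + 1) (v), b, j)))‖) ^ s ∂(wilsonMeasure (fundamentalRep (Fin 3)) (reg.β k))) / (∫ U : GaugeConfig 4 (2 * S + 1) (Matrix.specialUnitaryGroup (Fin 3) ℂ), ‖(diracMatrix U fun fl => reg.mcrit k + reg.a k * m fl / reg.Zm k).det‖ ∂(wilsonMeasure (fundamentalRep (Fin 3)) (reg.β k))) ≤ C * Real.exp (-(δ * (reg.a k * ‖v‖)))

/-- CONC = the crux's conclusion for `(reg, m)`, verbatim: ONE rate `δ' > 0` for all pairs of quark boxes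
`(A, B)` with `A` flavour-charged (`f₀`, `q ≠ 0`), constants `C'` depending on `(A, B)`. -/
def Conc (reg : QCDRegularisation Nf) (m : Fin Nf → ℝ) : Prop :=
  ∃ δ' : ℝ, 0 < δ' ∧ ∀ (R R' : ℕ) (A : QCDLatticeObservable Nf R) (B : QCDLatticeObservable Nf R'), (∃ (f₀ : Fin Nf) (q : ℤ), q ≠ 0 ∧ ∀ (θ : ℝ) (U : LGConfig 4 (Matrix.specialUnitaryGroup (Fin 3) ℂ)), ExteriorAlgebra.map (LinearMap.pi fun w => (Sum.elim (fun i => if (boxQuarkEquiv.symm i).1 = f₀ then Complex.exp (-((θ : ℂ) * Complex.I)) else 1) (fun i => if (boxQuarkEquiv.symm i).1 = f₀ then Complex.exp ((θ : ℂ) * Complex.I) else 1) (ofLex w)) • LinearMap.proj w) (A.F U) = Complex.exp (((q : ℝ) * θ : ℝ) * Complex.I) • A.F U) → ∃ C' : ℝ, ∀ᶠ k in atTop, ∀ S : ℕ, reg.L k ≤ S → ∀ n : ℕ, n ≤ S → ‖(∫ U : GaugeConfig 4 (2 * S + 1) (Matrix.specialUnitaryGroup (Fin 3) ℂ), (‖(diracMatrix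 U fun fl => reg.mcrit k + reg.a k * m fl / reg.Zm k).det‖ : ℂ) * (fermiIntegral (A.onTorus (2 * S + 1) 0 U * B.onTorus (2 * S + 1) (Pi.single 0 (n : ℤ)) U * fermiBoltzmann U fun fl => reg.mcrit k + reg.a k * m fl / reg.Zm k) / fermiIntegral (fermiBoltzmann U fun fl => reg.mcrit k + reg.a k * m fl / reg.Zm k)) ∂(wilsonMeasure (fundamentalRep (Fin 3)) (reg.β k))) / (∫ U : GaugeConfig 4 (2 * S + 1) (Matrix.specialUnitaryGroup (Fin 3) ℂ), (‖(diracMatrix U fun fl => reg.mcrit k + reg.a k * m fl / reg.Zm k).det‖ : ℂ) ∂(wilsonMeasure (fundamentalRep (Fin 3)) (reg.β k)))‖ ≤ C' * Real.exp (-(δ' * (reg.a k * n)))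

/-- The crux re-read through the packaging (definitional; mirrors the disprover's
`phaseQuenchedFlavourDecay_iff`). -/
theorem crux_iff :
    Summit.QuantumFields.QCD.Theses.PauliWegnerSea.PhaseQuenchedFlavourDecay ↔
      ∀ (Nf : ℕ) (reg : QCDRegularisation Nf) (m : Fin Nf → ℝ), (∀ f, 0 < m f) →
        Upper reg m → Conc reg m :=
  Iff.rfl

end Packaging

/-! ### §0c The three intermediate statements of the line -/

section LineProps

variable {Nf : ℕ}

/-- **SEA REPULSION (integrated, `r`-level, basis-free; the line's C⁺, conclusion of the HARDEST stub).**
For `(reg, m)`: there is ONE exponent `p > 1` such that for every minor size `r` there is `C_r` with,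
eventually in `k` and for every torus `S ≥ L_k`, for every `r`-tuple `I` of quark variables (any flavours,
sites, colours, spins),
`∫ det( |H(U)|^{-p} [I, I] ) dν_{k,S}(U) ≤ C_r`,
`ν_{k,S} = qcdLatticeMeasure` = the phase-quenched probability measure `∝ e^{-β_k S_W} ∏_f |det D_W(m_f(k))| dU`
at the bare masses `m_f(k)` (lower integral: a divergent expectation shows as `∞`, never as Bochner junk).
Unfolded: `E_ν Σ_{|S|=r} |det Φ_S(I)|² ∏_{α∈S} |λ_α|^{-p} ≤ C_r` — the `ν`-averaged `r`-point local
eigenvalue correlation measure of `Γ₅D` at `I`, integrated against `∏_t |λ_t|^{-p}`; `r = 1`, one flavour: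
`E_ν (|H_f|^{-p})(x,x) = ∫ |λ|^{-p} dμ̄_x(λ) ≤ C` ⟺ (up to the exponent endpoint) the card's LDOS vanishing
order `μ̄_x(-τ,τ) ≲ τ^{p}` = card `impurity-free-energy-minors`' `PQWegnerPlus` at zero impurity (one stub,
two consumers).  Because `H` is flavour-block-diagonal, a multi-flavour `I` gives the PRODUCT over flavours
of principal minors — the joint statement demanded by (M); flavour degeneracy `m_f(k) - m_{f'}(k) → 0`
forces `p < 1 + 1/N_f` (two flavours share each physical near-zero mode, the sea pays `|λ||λ + Δ|`), which
is free here since only `p > 1` is needed downstream. -/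
def SeaRepulsion (reg : QCDRegularisation Nf) (m : Fin Nf → ℝ) : Prop :=
  ∃ p : ℝ, 1 < p ∧ ∀ r : ℕ, ∃ C : ℝ, ∀ᶠ k in atTop, ∀ S : ℕ, reg.L k ≤ S →
    ∀ I : Fin r → QuarkVar Nf (2 * S + 1),
      (∫⁻ U, ENNReal.ofReal
          (((seaKernel U (bare reg m k) p).submatrix (fun t => quarkEquiv (I t))
              (fun t => quarkEquiv (I t))).det).re
        ∂(qcdLatticeMeasure (2 * S + 1) (reg.β k) (bare reg m k))) ≤ ENNReal.ofReal C

/-- **MINOR TAIL (the disprover's volume-uniform LOCAL TAIL, for all Wick minors; = card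
`crossing-split-integrability`'s a-priori integrability with ONE exponent for all `r`, QuarkVar-indexed).**
For `(reg, m)`: one `p > 1` such that for every `r` there is `B_r` with, eventually in `k`, for all
`S ≥ L_k`, all `I J : Fin r → QuarkVar` and all `t > 0`,
`ν_{k,S}{ U | t < |det D(U)⁻¹[I,J]| } ≤ B_r t^{-p}`  — no separation, no charge, no observables. -/
def MinorTail (reg : QCDRegularisation Nf) (m : Fin Nf → ℝ) : Prop :=
  ∃ p : ℝ, 1 < p ∧ ∀ r : ℕ, ∃ B : ℝ, ∀ᶠ k in atTop, ∀ S : ℕ, reg.L k ≤ S →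
    ∀ (I J : Fin r → QuarkVar Nf (2 * S + 1)) (t : ℝ), 0 < t →
      (qcdLatticeMeasure (2 * S + 1) (reg.β k) (bare reg m k)).real
          {U | t < wickMinor U (bare reg m k) I J} ≤ B * t ^ (-p)

/-- **CHARGED MINOR DECAY (the Wick-level form of the crux's conclusion, with the quantifier order (Q):
the rate is chosen BEFORE the minor).**  For `(reg, m)`: ONE `δ' > 0` such that for every minor size `r`
and box radius `R` there is `C'` with, eventually in `k`, for all `S ≥ L_k`, `n ≤ S`, every flavour `f₀`,
all index tuples `I` (rows, `ψ`) and `J` (columns, `ψ̄`) with side labels `sI, sJ` (`true` = the `A`-box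
about `0`, `false` = the `B`-box about `n e₀`; each index sits in the ball of radius `R` of its side), IF
the `f₀`-CHARGE OF THE `A`-SIDE IS UNBALANCED (`#{A-side rows of flavour f₀} ≠ #{A-side columns of
flavour f₀}` — what `Charged_{f₀, q ≠ 0} A` forces on every Wick monomial), THEN
`⟨ |det D⁻¹[I,J]| ⟩₊ ≤ C' e^{-δ' a_k n}` (tree `qcdPhaseQuenchedExpect` = the crux's quotient,
`qcdPhaseQuenchedExpect_eq_div`; `|det D|·|minor| = |complementary minor of D|` is bounded, so no junk). -/
def ChargedMinorDecay (reg : QCDRegularisation Nf) (m : Fin Nf → ℝ) : Prop :=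
  ∃ δ' : ℝ, 0 < δ' ∧ ∀ r R : ℕ, ∃ C' : ℝ, ∀ᶠ k in atTop, ∀ S : ℕ, reg.L k ≤ S → ∀ n : ℕ, n ≤ S →
    ∀ (f₀ : Fin Nf) (I J : Fin r → QuarkVar Nf (2 * S + 1)) (sI sJ : Fin r → Bool),
      (∀ t, InBall S (if sI t then 0 else Pi.single 0 (n : ℤ)) R (siteOf (I t))) →
      (∀ t, InBall S (if sJ t then 0 else Pi.single 0 (n : ℤ)) R (siteOf (J t))) →
      (Finset.univ.filter fun t => sI t = true ∧ (I t).1 = f₀).card ≠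
        (Finset.univ.filter fun t => sJ t = true ∧ (J t).1 = f₀).card →
      qcdPhaseQuenchedExpect (reg.β k) (2 * S + 1) (bare reg m k)
          (fun U => wickMinor U (bare reg m k) I J) ≤
        C' * Real.exp (-(δ' * (reg.a k * n)))

end LineProps

/-! ### §1 Registered stubs -/

/-- **Stub A — SEA REPULSION UNDER LOCALISATION (the physics; HARDEST; open).**
`∀ N_f reg m > 0, Upper(reg,m) → SeaRepulsion(reg,m)`.
Why plausibly true: the weight is `∏_f ∏_α |λ^f_α|`, vanishing to first order exactly on the divisor where
a pole of `|H|^{-p}` sits, so each of the `r` distinct poles of `det(|H|^{-p})[I,I]` is paid once by the sea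
(`∫ |λ|^{1-p} dλ < ∞` for `p < 2`; shared physical modes of `N_f'` near-degenerate flavours give
`∫ ∏|λ+Δ_f|^{1-p} < ∞` uniformly in the splittings iff `p < 1 + 1/N_f'`); in-gap (dislocation) modes are
localised under UPPER and, if dilute per localisation volume, Poisson — then the bound holds mode by mode
with `C_r ~ (local quenched Wegner density)^r`; bulk modes above the physical edge `a_k m` have lattice DOS
`∝ |λ|³`, harmless.  Toy evidence (card, kit j007146, 2D U(1) `β = 0`, `L = 6`): `|det|`-weighted IDS slope
`1.90` vs quenched `1.02` (`p` up to ≈ 1.9 at `N_f = 1`, `r = 1`), two-mode local count slope `5.11 > 4`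
(`r = 2`).  WHY IT MIGHT FAIL (triage [RES], r1-2/r1-3): LDOS depletion beyond `O(1)` level spacings is a
LOCALISATION statement — under extended-state (Wigner–Dyson) statistics of in-gap modes the tilt is a weak
linear statistic and `μ̄_x(-τ,τ) ≈ ρ_q τ` mesoscopically (`p = 1`, no gain): hence the UPPER guard (§B:
unguarded it is false on admissible `N_f = 2` degenerate Aoki-phase regs, `ρ_{H_W}(0) > 0`,
SharpeSingleton1998 §4/§6, Barriers `AokiPhase`/`BanksCasher`); and `k`-UNIFORMITY of `C_r` needs in-gap
modes dilute per localisation 4-volume (`ρ_q(k) ξ_k⁴ = O(1)`, GoltermanShamir2003 p.8) or polynomially rare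
in `a_k` — not visibly implied by UPPER (which only gives `ξ_k ≲ 1/(δ a_k)`); this is the dislocation-rarity
bet the routes already carry in `OneScaleTrajectory`, here in its weakest form (any `p > 1`).  Note the crux
itself already needs `ρ_q(k) log(1/a_k) = O(1)` at `n = 0` in that scenario, so the extra strength is a power
`a_k^{0+}` versus a logarithm.  WHY EASIER THAN THE CRUX (Transfer): local (no separation `n`, no
observables, no charge), positive integrand, one canonical spectral object per `(k,S)`, and by torus
translation invariance a statement about ONE random Hermitian matrix `Γ₅D` — the natural target of
Wegner–Minami technology, of the two-star/Feshbach fibre analysis (cards `feshbach-fibre-tameness`, route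
items K1/K3: on the fibre of the star of `x`, `(H - z)⁻¹(x,x)` is a `12 × 12` matrix Herglotz function of 8
links), of the impurity free energy (card `impurity-free-energy-minors`, `r`-uniform FIRST moments), and of
Wilson χRMT (SplittorffVerbaarschot2011 "repulsion from the origin").  Size: open-problem core; its `r = 1`
heavy-mass corner is provable now from `QCDHeavyQuarkPropagator` (Neumann series, `|λ| ≥ m₀ > 0`).
Sources: arXiv:1105.6229, doi:10.1103/physrevlett.105.162002, Minami1996, CombesGerminetKlein2009,
AizenmanWarzel2015 Ch. 17, GoltermanShamir2003, SharpeSingleton1998. -/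
theorem stub_seaRepulsion :
    ∀ (Nf : ℕ) (reg : QCDRegularisation Nf) (m : Fin Nf → ℝ), (∀ f, 0 < m f) →
      Upper reg m → SeaRepulsion reg m := by
  sorry

/-- **Stub B — MINOR DOMINATION (the line's first NEW lemma; deterministic linear algebra + Markov;
provable now, size L).**  `∀ N_f reg m, SeaRepulsion(reg,m) → MinorTail(reg,m)` with the SAME `p`.
The work, pointwise in `U` with `D = diracMatrix U mq` invertible (else `D⁻¹ = 0` and the minor vanishes):
(1) `hermitianDiracMatrix_eq_mul : H = Γ * D` and `gammaBig_mul_self : Γ² = 1` (both sorry-free in this file),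
`Γ` the reindexed block-diagonal `spinorLift gammaFive`, a DIAGONAL `±1` matrix (`spinorLift_gammaFive_eq_diagonal`),
so `D⁻¹ = H⁻¹ Γ` and `|det D⁻¹[I,J]| = |det H⁻¹[I,J]|` (column signs);
(2) COMPOUND MATRICES (Cauchy–Binet = multiplicativity of `r`-th compounds `C_r`):
`C_r(H⁻¹) = C_r(|H|^{-1/2}) C_r(sgn H) C_r(|H|^{-1/2})` with `C_r(sgn H)` unitary and `C_r(|H|^{-1/2})`
positive, hence by Cauchy–Schwarz `|det H⁻¹[I,J]|² ≤ det(|H|⁻¹)[I,I] · det(|H|⁻¹)[J,J]`;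
(3) JENSEN: `det(|H|⁻¹)[I,I] = Σ_S π_S a_S` with `π_S = |det Φ_S(I)|²`, `Σ_S π_S = det 1[I,I] = 1`
(`I` injective; else everything is `0`), `a_S = ∏_{α∈S}|λ_α|⁻¹`, so `(det(|H|⁻¹)[I,I])^p ≤ det(|H|^{-p})[I,I]`
for `p ≥ 1`, and with `√(ab) ≤ (a+b)/2`, convexity of `x^p`:
`|det D⁻¹[I,J]|^p ≤ ½ (det(|H|^{-p})[I,I] + det(|H|^{-p})[J,J])` — all through `Matrix.IsHermitian.cfc_eq`
for `seaKernel`; (4) integrate against `ν_{k,S}` (both sides measurable: `cfc` of a continuous matrix-valued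
map is a pointwise limit of continuous ones) and MARKOV under the probability measure `qcdLatticeMeasure`
(`isProbabilityMeasure_qcdLatticeMeasure`; if `∫|det| dμ_W = 0` the measure is `0` and the tail bound is
trivial): `ν{t < |minor|} ≤ t^{-p} E_ν|minor|^p ≤ ½(C_I + C_J) t^{-p}`, i.e. `B_r = C_r` of `SeaRepulsion`.
Why it might need reshaping: only Lean infrastructure (rectangular Cauchy–Binet / compound matrices are
thin in Mathlib: `Matrix.det_mul` is square; the prover may prefer the direct route
`H⁻¹[I,J] = Φ(I) Λ⁻¹ Φ(J)†` + `Matrix.det_mul` on `r × n · n × n · n × r` via Cauchy–Binet proved ad hoc),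
not the mathematics.  Leans on: `Matrix.IsHermitian.cfc_eq`, `eigenvectorUnitary`, `spectral_theorem`,
`isHermitian_hermitianDiracMatrix` (this file), `norm_det_mul_norm_inv_apply_le`-style adjugate bounds,
`isProbabilityMeasure_qcdLatticeMeasure`, `MeasureTheory.meas_ge_le_lintegral_div` (Markov). -/
theorem stub_minorDomination :
    ∀ (Nf : ℕ) (reg : QCDRegularisation Nf) (m : Fin Nf → ℝ),
      SeaRepulsion reg m → MinorTail reg m := by
  sorry

/-- **Stub C — CROSSING SPLIT (probability; provable now, size L; the transfer that respects (Q)).**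
`∀ N_f reg m > 0, Upper(reg,m) → MinorTail(reg,m) → ChargedMinorDecay(reg,m)`.
The work (card `crossing-split-integrability`, `SplitBound` verified line by line by all three triagers,
here fed with the TAIL form): fix `(r, R)`, a charged configuration `(f₀, I, J, sI, sJ)` and `n ≤ S`.
(0) If `n ≤ 2R + 1` use only the a-priori bound `⟨|minor|⟩₊ ≤ 1 + B_r p/(p-1)` (layer cake from `MinorTail`,
tree `phaseQuenched_firstMoment_le_of_fractionalMoment_of_tail` pattern) and put `e^{δ'(2R+1) sup_k a_k}`
into `C'`.  (1) Else the two balls are disjoint and side = position.  LAPLACE BY CROSSING MATCHINGS: the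
minor factorises over flavours; in the `f₀`-block the `A`-side has `a` rows and `b ≠ a` columns, so every
permutation term contains `≥ |a-b| ≥ 1` CROSSING entry `G_{f₀}(w, v)` with `w, v` on different sides
(torus distance `≥ n - 2R`); grouping permutations by their crossing partial matching `μ`
(generalised Laplace expansion) gives, on the event `Ωᶜ = {all crossing entries ≤ η}` (`η ≤ 1`),
`X := |det D⁻¹[I,J]| ≤ η · Y`, `Y = Σ_μ |minor_AA^μ| · |minor_BB^μ|` (`≤ (r!)²` terms, each a product of
two minors of complementary sizes).  (2) ON `Ω`: `⟨X 1_Ω⟩₊ ≤ K ν(Ω) + ⟨X 1{X > K}⟩₊ ≤ K ν(Ω) + B_r (p/(p-1)) K^{1-p}`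
(height split = the idea card's Chebyshev lever, tail from `MinorTail`), and
`ν(Ω) ≤ Σ_{crossing pairs} ν(|G_{f₀}(w,v)| > η) ≤ r² η^{-s} C e^{-δ a_k (n - 2R)}` by MARKOV on UPPER
(the colour–spin block sum dominates each entry) transported from the origin to `w` by TORUS TRANSLATION
INVARIANCE of `ν` (`wilsonMeasure_map_torusConfigShift`, covariance of `diracMatrix`); optimise `K`.
(3) OFF `Ω`: `⟨X 1_{Ωᶜ}⟩₊ ≤ ⟨X^{1-α} (ηY)^α⟩₊ ≤ η^α ⟨X⟩₊^{…} …` — Hölder with `√Y ≤ Σ_μ ½(|minor_AA^μ| +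
|minor_BB^μ|)` (AM–GM never multiplies two minors) and the a-priori first / `(1+ε)`-moments of single
minors from `MinorTail` (`ε < p - 1`), exactly `SplitBound` with `q = 1`.  (4) Choose `η = e^{-κ a_k n}`:
rate `δ' = δ · c(s, p) > 0` INDEPENDENT of `(r, R, I, J)` — only `C'` sees `r, R` (through `B_r`, `(r!)²`,
`r²`).  Uses UPPER essentially (Disproof `_false_without_upper`) and the charge imbalance essentially
(`q = 0` ⇒ no crossing entry ⇒ no decay: Disproof `_false_without_charge`).  Why it might need reshaping:
torus bookkeeping (`InBall` representatives, `n` close to `S`: torus distance `≥ min(n, 2S+1-n) - 2R ≥ n - 2R`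
fails for `n > S + ½`, excluded by `n ≤ S`).  Leans on: `FractionalMomentTail.integral_le_of_fractionalMoment_of_tail`,
`QCDPhaseQuenchedMomentUpgrade.*`, `qcdPhaseQuenchedExpect_eq_integral_qcdLatticeMeasure`, `_eq_div`,
`integrable_norm_inv_diracMatrix_apply_qcdLatticeMeasure`, `Matrix.det_apply` / `Finset.sum` Laplace
bookkeeping, `MeasureTheory.integral_mul_le_Lp_mul_Lq_of_nonneg`; AizenmanWarzel2015 Ch. 7 (resonance tails). -/
theorem stub_crossingSplit :
    ∀ (Nf : ℕ) (reg : QCDRegularisation Nf) (m : Fin Nf → ℝ), (∀ f, 0 < m f) →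
      Upper reg m → MinorTail reg m → ChargedMinorDecay reg m := by
  sorry

/-- **Stub D — WICK REDUCTION (Grassmann algebra; provable now, size L).**
`∀ N_f reg m, ChargedMinorDecay(reg,m) → Conc(reg,m)` with the SAME `δ'`.
The work: fix `(R, R', A, B)` with `Charged_{f₀,q} A`, `q ≠ 0`; put `R̄ = max R R'`.
(1) EXPANSION: `A.F U = Σ_T c_T(U) e_T` over the finite monomial basis `e_T` of the boxed Grassmann algebra
(`T ⊆ BoxFermiIdx ⊕ BoxFermiIdx`), `c_T(U) = ± berezin(A.F U * e_{Tᶜ})`, so `sup_U |c_T(U)| ≤ C_T < ∞` by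
the structure field `QCDLatticeObservable.bounded` (finitely many `T`); same for `B`.
(2) CHARGE SELECTION RULE: the phase map of the crux multiplies `e_T` by `e^{i(p_T - p̄_T)θ}`
(`p_T`, `p̄_T` = numbers of `ψ_{f₀}`, `ψ̄_{f₀}` generators in `T`); monomials are linearly independent, so
`Charged` (all `θ`) forces `c_T ≡ 0` unless `p_T - p̄_T = q ≠ 0` (pick `θ` with `e^{i(p_T - p̄_T - q)θ} ≠ 1`)
— tree `IsFlavourCharged` / `GrassmannGaussianChargeRule` patterns.
(3) WICK IN DETERMINANT FORM: `onTorus` places monomials at `0` and at `n e₀` (images are monomials or `0`);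
`fermiIntegral(e_I^ψ e_J^{ψ̄} · fermiBoltzmann U) = ± det D · det D⁻¹[I,J]` for `det D ≠ 0`
(`berezin_grassmannExp_quadratic_mul_prod`, `fermiIntegral_fermiBoltzmann = ± det D`), monomials with
`#ψ ≠ #ψ̄` integrate to `0`; on `{det D = 0}` the Berezin ratio is `x / 0 = 0` in Lean AND the weight `|det D|`
vanishes, so the integrand is `0` on both sides of the comparison.  Hence the crux's complex quotient
(`qcdPhaseQuenchedExpect_eq_div_complex`) is `Σ_{T,T'} ⟨ c_T c'_{T'} · (± det D⁻¹[I_{T,T'}, J_{T,T'}]) ⟩₊`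
with every `(I, J)` CHARGED in the sense of `ChargedMinorDecay` (A-side `f₀`-rows minus `f₀`-columns
`= q ≠ 0`, side labels from which factor the generator came, supports in balls of radius `R̄`).
(4) `‖⟨Σ⟩₊‖ ≤ Σ C_T C'_{T'} ⟨|minor|⟩₊ ≤ (Σ C_T C'_{T'} C'(r_{T,T'}, R̄)) e^{-δ' a_k n}`; finitely many
`(r, R̄)` occur (`r ≤ 24 N_f (2R̄+1)⁴`), so the `∀ᶠ k` sets intersect (`Filter.eventually_all_finset`).
Honours Disproof `_false_without_charge` / `_false_without_qNeZero` (this is the ONLY place the charge is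
used, and it is used).  Why it might need reshaping: the monomial-basis API of `GrassmannAlgebra`
(coefficient extraction by Berezin pairing) may need helper lemmas `--supports` this decl.  Leans on:
`GrassmannGaussianMoments.berezin_grassmannExp_quadratic_mul_prod` / `_mul_noncommProd`,
`GrassmannGaussianChargeRule.berezin_grassmannExp_quadratic_mul_word_eq_zero`, `fermiIntegral_fermiBoltzmann`,
`QCDLatticeObservable.bounded`, `.onTorus`, `qcdPhaseQuenchedExpect_eq_div_complex`, `_add`, `_smul`,
`FermiFlavourPhase.IsFlavourCharged`; MontvayMunster1994 §4.1, Berezin1966 Ch. I §3. -/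
theorem stub_wickReduction :
    ∀ (Nf : ℕ) (reg : QCDRegularisation Nf) (m : Fin Nf → ℝ),
      ChargedMinorDecay reg m → Conc reg m := by
  sorry

/-! ### §2 Name-keyed aliases of the four stub STATEMENTS (the hypotheses of the composition)

The native skeleton audit (`#h21_check_skeleton`) admits a hypothesis of `<Crux>_of` only BY NAME (head constant whose
short name is a registered stub), so each stub statement is restated verbatim as an `abbrev` keyed by the stub's name
(same device as `Cruxes/MazurKaneLaw/Lines/fibre-toolkit-lp-wall-map.lean`).  The `example`s at the end check that the
registered `stub_*` theorems inhabit these aliases definitionally. -/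
namespace Registered

/-- Alias of the statement of `stub_seaRepulsion`. -/
abbrev stub_seaRepulsion : Prop :=
  ∀ (Nf : ℕ) (reg : QCDRegularisation Nf) (m : Fin Nf → ℝ), (∀ f, 0 < m f) →
    Upper reg m → SeaRepulsion reg m

/-- Alias of the statement of `stub_minorDomination`. -/
abbrev stub_minorDomination : Prop :=
  ∀ (Nf : ℕ) (reg : QCDRegularisation Nf) (m : Fin Nf → ℝ), SeaRepulsion reg m → MinorTail reg m

/-- Alias of the statement of `stub_crossingSplit`. -/
abbrev stub_crossingSplit : Prop :=
  ∀ (Nf : ℕ) (reg : QCDRegularisation Nf) (m : Fin Nf → ℝ), (∀ f, 0 < m f) →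
    Upper reg m → MinorTail reg m → ChargedMinorDecay reg m

/-- Alias of the statement of `stub_wickReduction`. -/
abbrev stub_wickReduction : Prop :=
  ∀ (Nf : ℕ) (reg : QCDRegularisation Nf) (m : Fin Nf → ℝ), ChargedMinorDecay reg m → Conc reg m

end Registered

/-! ### §3 Composition (no `sorry` below this line) -/

/-- **`PhaseQuenchedFlavourDecay` (route `PauliWegnerSea`, the payload's primary route) from the four stubs**
(kernel-checked, no `sorry` of its own; hypotheses are the stub statements by name): read the crux through `crux_iff`;
sea repulsion (A) ⇒ minor tail (B) ⇒ charged minor decay (C, using UPPER again) ⇒ the conclusion (D). -/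
theorem PhaseQuenchedFlavourDecay_of (hA : Registered.stub_seaRepulsion) (hB : Registered.stub_minorDomination)
    (hC : Registered.stub_crossingSplit) (hD : Registered.stub_wickReduction) :
    Summit.QuantumFields.QCD.Theses.PauliWegnerSea.PhaseQuenchedFlavourDecay := by
  refine crux_iff.mpr ?_
  intro Nf reg m hm hU
  exact hD Nf reg m (hC Nf reg m hm hU (hB Nf reg m (hA Nf reg m hm hU)))

/-- The shared decl of the sibling route is the same proposition (both gate files carry byte-identical texts,
definitionally equal). -/
theorem wilsonMobilityGap_iff_pauliWegnerSea :
    Summit.QuantumFields.QCD.Theses.WilsonMobilityGap.PhaseQuenchedFlavourDecay ↔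
      Summit.QuantumFields.QCD.Theses.PauliWegnerSea.PhaseQuenchedFlavourDecay :=
  Iff.rfl

/-- **`PhaseQuenchedFlavourDecay` (route `WilsonMobilityGap`, the item's own decl) from the same four stubs** —
this is the theorem the skeleton audit keys on (`ledger skeleton check` resolves stmt-QuantumFields-9151 to this decl). -/
theorem WilsonMobilityGap_PhaseQuenchedFlavourDecay_of (hA : Registered.stub_seaRepulsion)
    (hB : Registered.stub_minorDomination) (hC : Registered.stub_crossingSplit)
    (hD : Registered.stub_wickReduction) :
    Summit.QuantumFields.QCD.Theses.WilsonMobilityGap.PhaseQuenchedFlavourDecay :=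
  wilsonMobilityGap_iff_pauliWegnerSea.mpr (PhaseQuenchedFlavourDecay_of hA hB hC hD)

/-- Wiring check: the registered stubs feed the composition as stated (each `stub_*` inhabits its alias
definitionally); the crux modulo the four `sorry`s and nothing else. -/
example : Summit.QuantumFields.QCD.Theses.PauliWegnerSea.PhaseQuenchedFlavourDecay :=
  PhaseQuenchedFlavourDecay_of stub_seaRepulsion stub_minorDomination stub_crossingSplit stub_wickReduction

example : Summit.QuantumFields.QCD.Theses.WilsonMobilityGap.PhaseQuenchedFlavourDecay :=
  WilsonMobilityGap_PhaseQuenchedFlavourDecay_of stub_seaRepulsion stub_minorDomination stub_crossingSplit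
    stub_wickReduction

end Summit.QuantumFields.QCD.Cruxes.PhaseQuenchedFlavourDecay.SeaRepulsionExponent

end
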